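import Summits.BirchSwinnertonDyer.BirchSwinnertonDyer.Theorems.ResidualThetaTransportAtTwoResidualSignedLambdaLowerCMAtTwoCofreeShapiroTransport
import Summits.BirchSwinnertonDyer.BirchSwinnertonDyer.Theorems.ThetaPartnerAtTwoSignedMainConjectureCMTwoRankZeroPTDeepTransferTools
import Literature.NumberTheory.EllipticCurves.CyclotomicLayerRhoTatePairingPk
import Literature.NumberTheory.EllipticCurves.GreenbergVatsal2000.ResidualSelmerGroups
import HarnessLib

/-!
# Stub-ideation k3·g14 (technique: DECOMPOSITION with a PROVED glue) for `stub_cmLambdaLower` = RSL_g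
# `ResidualSignedLambdaLowerCMAtTwo` (stmt-BirchSwinnertonDyer-22608), crux (R≥)ᵖ `ResidualThetaCountLowerPureAtTwo`
# (stmt-BirchSwinnertonDyer-26074), skeleton `Lines/bt26_lambda.lean` v6.

## THE PIECE DECOMPOSED: k3-g13's residue T3♭ of the items-6/7 transfer (T)_ρ — the KUMMER clause (3)/(3♭) at `v ∣ p`

k3-g13 decomposed the ρ-coefficient transfer `τ_{n,N} = res_{Γ_∞ ≤ Γ_n} ∘ (A_ρ[N] ↪ A_ρ)_*` of items 6/7
(`stub_deepHalfAtTwoStrict` S4₂ / `stub_deepHalfAwayTwo` S4₀) into T1 [unr] · T2 [inf] · T3 [strict at p] (all PROVED there)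
and left ONE untyped arithmetic residue for item 6:

  T3♭  «for every `y ∈ H¹(Γ_∞, A_ρ)`, `v ∋ p`, `σ`: `loc_v(conj_σ y)` is a Θ-Kummer class of tower points»
       (= Coates–Greenberg read through `Θ`). The stub-critic (STUB-PLAN rev 19: S78 / T47 / U63 / Q79) CORRECTED the target:
       Coates–Greenberg is a THEOREM in the tree (`CoatesGreenberg1996_H1_formalGroup_trivial_holds`) but yields only the RELAXED
       clause, whereas clause (3) of RSL_g's counted set is PLUS-signed (`⨆ m, signedLocalPoints κ ℚ_v W 1 m`); the residue OF
       RECORD for item 6 (S4₂ `stub_deepHalfAtTwoStrict`) is **T3♮ = the Kummer-witness TRANSPORT at `v ∣ 2`** — the ρ/Θ-twin of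
       TP2's `PTDeepTransferTools` §3–§4 over `thetaLayerKummer` — listed OPEN in rev 19 pt 4 and requested in Q79.

THIS FILE PROVES T3♮ and decomposes item 6's local step at `v ∣ 2` as  [kum]_n ⟹(T3♮) witness on `Γ_n` ⟹(ORB) clause (3) ∀σ,
with every implication PROVED (0 sorry) and the end product in RSL_g's exact binder shape at `p = 2` (§5):

* [kum]_n (item 6's FOURTH hypothesis, S78 — supplied by S4₂'s strict levelwise structure, B7 «points^⊥ = points» on the PLUS
  side; NOT a new statement): `layerLocOf b = thetaLayerKummer … n P` with `P ∈ (E⁺(ℚ_{n,v}))^r` — Kummer AT LEVEL `n` by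
  construction of the dual structure; no Coates–Greenberg anywhere (T47).
* T3♮ (§2, `exists_thetaKummerWitness_pushH1`): **a level class whose localisation at `U_n` is the Θ-Kummer class of
  `P ∈ E(ℚ_{n,v})^r` pushes to a class of `H¹(Γ_n, A_ρ)` with a Θ-Kummer WITNESS `(φ, R)`, `p^k R = P` ON THE NOSE**
  (the two cocycles differ on `U_n` by a coboundary `τt − t`, `t ∈ A_ρ[p^k]`; `R_i = P'_i + (Θ t)_i`) — the ρ/Θ twin of TP2's
  `SignedLowerOffTwo.PTDeep.exists_kummerWitness_push_of_layerLoc_eq_layerKummer` (W-coefficients, one coordinate).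
* ORB (§1): the Θ-Kummer condition w.r.t. ANY `Γ_v`-stable group of points `B` is stable under restriction `Γ_n → Γ_∞`
  (`ThetaKummerAt.resOfLe`) and under ALL conjugations `conj_σ`, `σ ∈ Γ_ℚ`, at `v ∣ p` for the cyclotomic tower
  (`ThetaKummerAt.conjH1`: one orbit `Γ_ℚ = θ(Γ_v)·Γ_∞`, inner classes act trivially, `hΘ`) — so the `∀ σ` of RSL_g's clause (3)
  costs nothing at `v ∣ 2`.
* GLUE (§3): `thetaKummerAt_conjH1_transferH1` and its unfolded forms — for EVERY `Γ_v`-stable `B ∋ P_i` the transferred class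
  `conj_σ (τ b)` satisfies «`∃ φ Q k, [φ] = conj_σ (τ b) ∧ (∀ i, p^k • Q i ∈ B) ∧ ∀ τ i, ι(Θ(φ(res τ))_i) = τ•Q_i − Q_i`» — with
  `B = ⨆_m E^ε(ℚ_{m,v})` when the `P_i` are ε-signed (`conjH1_transferH1_kummer_signed`: RSL_g's clause (3) for `p = 2`, `ε = 1`),
  `B = E(ℚ_∞·ℚ_v)` (all tower points: the relaxed clause (3♭) of the v2 cut's `SelRel`), or `B = ⨆_m E(ℚ_{m,v})` (§4).
* AT TWO (§5, `clauseThree_conjH1_transferH1_atTwo`): `Θ`, `hΘ` as families over `v ∋ 2` exactly as bound in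
  `ResidualSignedLambdaLowerCMAtTwo`, conclusion = its clause (3) VERBATIM for `y := transferH1 … b` and every `σ`.

Everything is generic in `p`, `S`, `d`, `r`, `κ` (cyclotomic only where the orbit argument needs it); no pins, no `SelRel`, no count.
HONEST FRAMING: Galois-cohomological plumbing; RSL_g (22608) and (R≥)ᵖ (26074) stay OPEN; BSD is NOT proved by any of this.
References: [Kobayashi2003] Def. 1.1, §2 (p. 4), (8.23) (p. 18); [Greenberg1989] §1 p. 98; [GreenbergLNM1716] §2;
[SilvermanAEC2009] VIII §2; [SerreGaloisCohomology1997] I §2.4–2.5, §5.1; [SerreLocalFields1979] VII §5 Prop. 3;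
[NeukirchSchmidtWingberg2008] I §5 (1.5.2)–(1.6.3); [Washington1997] §13.1; [PerrinRiou1994Asterisque229] §1.3.
-/

set_option autoImplicit false
set_option linter.dupNamespace false

noncomputable section

open scoped Classical NumberField

namespace Summit.BirchSwinnertonDyer.BirchSwinnertonDyer.Cruxes.ResidualThetaCountLowerPureAtTwo.StubIdeasK3G14

open Field IsDedekindDomain NumberField
  Literature.NumberTheory.EllipticCurves Literature.NumberTheory.GaloisRepresentations
  Literature.NumberTheory.EllipticCurves.GreenbergSelmer Literature.NumberTheory.EllipticCurves.GreenbergVatsal2000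
  Literature.NumberTheory.EllipticCurves.Kobayashi2003 Literature.NumberTheory.EllipticCurves.Sprung2012
  Literature.NumberTheory.EllipticCurves.CyclotomicLayer ZpExtension
  Summit.BirchSwinnertonDyer.BirchSwinnertonDyer.Theorems

variable {p : ℕ} [Fact p.Prime] (S : Set (PadicAlgCl p)) {d : ℕ} (ρ : FramedGaloisRep ℚ ↥(padicCoeffIntegers S) d)
  (W : WeierstrassCurve ℚ) {r : ℕ}
  (Θ : Cofree ρ ↥(padicCoeffField S) ≃+ (Fin r → ↥(W.geomPrimaryTorsion p))) (κ : ZpExtension ℚ p)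
  (v : HeightOneSpectrum (𝓞 ℚ))
  (hΘ : ∀ (δ : absoluteGaloisGroup (v.adicCompletion ℚ)) (m : Cofree ρ ↥(padicCoeffField S)) (i : Fin r),
    Θ (resGalOfEmb (closureEmb (K := ℚ) (v.adicCompletion ℚ)) δ • m) i =
      resGalOfEmb (closureEmb (K := ℚ) (v.adicCompletion ℚ)) δ • Θ m i)

/-! ## §1 The Θ-Kummer condition at a subgroup `H ≤ Γ_ℚ` w.r.t. a group of local points `B` (RSL_g's clause (3), parametrised) -/

/-- **`ThetaKummerAt Θ H B y`** — the matrix of RSL_g's clause (3) at the place of `v`, for a class `y ∈ H¹(H, A_ρ)` (`H = Γ_∞` there),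
with the target group of points `B` a parameter (`⨆_m E⁺(ℚ_{m,v})` in RSL_g; all tower points in the v2 cut's relaxed set (C4)):
`∃ φ Q k, [φ] = y ∧ (∀ i, p^k Q_i ∈ B) ∧ ∀ τ ∈ H_v, ∀ i, ι((Θ φ(res τ))_i) = τQ_i − Q_i`. A sketch-local name only (the lead's `SelRel` is the
authority); every theorem below is also given unfolded. [cite: Greenberg1989, §1 p. 98] [cite: Kobayashi2003, Def. 1.1] -/
def ThetaKummerAt (H : Subgroup (absoluteGaloisGroup ℚ)) (B : AddSubgroup (localPoints W (v.adicCompletion ℚ)))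
    (y : subgroupH1 H (Cofree ρ ↥(padicCoeffField S))) : Prop :=
  ∃ (φ : contOneCocycles (discreteTopRep H (Cofree ρ ↥(padicCoeffField S))))
    (Q : Fin r → localPoints W (v.adicCompletion ℚ)) (k : ℕ),
    oneCocycleClass _ φ = y ∧ (∀ i, (p ^ k) • Q i ∈ B) ∧
      ∀ (τ : localSubgroupOfEmb H (closureEmb (K := ℚ) (v.adicCompletion ℚ))) (i : Fin r),
        pointsMapOfEmb W (closureEmb (K := ℚ) (v.adicCompletion ℚ))
            (((Θ (φ.1 (resGalSubgroupOfEmb H (closureEmb (K := ℚ) (v.adicCompletion ℚ)) τ))) i : ↥(W.geomPrimaryTorsion p)) :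
              W.geomPoints) =
          (τ : absoluteGaloisGroup (v.adicCompletion ℚ)) • Q i - Q i

namespace ThetaKummerAt

variable {S ρ W Θ κ v}

/-- Monotonicity in the target group of points. [cite: Kobayashi2003, Def. 1.1] -/
theorem mono {H : Subgroup (absoluteGaloisGroup ℚ)} {B B' : AddSubgroup (localPoints W (v.adicCompletion ℚ))} (hBB' : B ≤ B')
    {y : subgroupH1 H (Cofree ρ ↥(padicCoeffField S))} (hy : ThetaKummerAt S ρ W Θ v H B y) :
    ThetaKummerAt S ρ W Θ v H B' y := by
  obtain ⟨φ, Q, k, hφ, hQ, hτ⟩ := hy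
  exact ⟨φ, Q, k, hφ, fun i ↦ hBB' (hQ i), hτ⟩

/-- **Restriction `H → H₀` (`H₀ ≤ H`, e.g. `Γ_∞ ≤ Γ_n`) preserves the Θ-Kummer condition** (same points `Q`, restricted cocycle).
[cite: SerreGaloisCohomology1997, I §2.4] [cite: PerrinRiou1994Asterisque229, §1.3] -/
theorem resOfLe {H₀ H : Subgroup (absoluteGaloisGroup ℚ)} (h : H₀ ≤ H) {B : AddSubgroup (localPoints W (v.adicCompletion ℚ))}
    {y : subgroupH1 H (Cofree ρ ↥(padicCoeffField S))} (hy : ThetaKummerAt S ρ W Θ v H B y) :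
    ThetaKummerAt S ρ W Θ v H₀ B (Literature.NumberTheory.EllipticCurves.resOfLe (Cofree ρ ↥(padicCoeffField S)) h y) := by
  obtain ⟨φ, Q, k, rfl, hQ, hτ⟩ := hy
  refine ⟨contOneCocycles.pullback (subgroupInclusion h)
      (resHomOfEquivariant (subgroupInclusion h) (AddMonoidHom.id _) fun _ _ ↦ rfl) φ, Q, k, ?_, hQ, fun τ i ↦ ?_⟩
  · rw [Literature.NumberTheory.EllipticCurves.resOfLe, resH1Hom_oneCocycleClass]
  · have hτ' : (τ : absoluteGaloisGroup (v.adicCompletion ℚ)) ∈ localSubgroupOfEmb H (closureEmb (K := ℚ) (v.adicCompletion ℚ)) :=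
      (mem_localSubgroupOfEmb_iff H _ _).2 (h ((mem_localSubgroupOfEmb_iff H₀ _ _).1 τ.2))
    have e : subgroupInclusion h (resGalSubgroupOfEmb H₀ (closureEmb (K := ℚ) (v.adicCompletion ℚ)) τ) =
        resGalSubgroupOfEmb H (closureEmb (K := ℚ) (v.adicCompletion ℚ)) ⟨τ, hτ'⟩ := Subtype.ext rfl
    rw [pullback_resHomOfEquivariant_apply, AddMonoidHom.id_apply, e]
    exact hτ ⟨_, hτ'⟩ i

/-- **Conjugation by `θ(δ)`, `δ ∈ Γ_v`, preserves the Θ-Kummer condition w.r.t. a `δ`-stable `B`** (the witness `(φ, Q)` goes to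
`(conj φ, δ•Q)`; uses the equivariance `hΘ` of the transport at `v`). ρ/Θ-twin of TP2's `kummerWitness_conj_layer` /
`conjH1_mem_localKummerOverOfEmb_layer_of_smul_mem`. [cite: SerreGaloisCohomology1997, I §2.5] [cite: Kobayashi2003, §2 (p. 4)] -/
theorem conjH1_resGalOfEmb (hΘ : ∀ (δ : absoluteGaloisGroup (v.adicCompletion ℚ)) (m : Cofree ρ ↥(padicCoeffField S)) (i : Fin r),
      Θ (resGalOfEmb (closureEmb (K := ℚ) (v.adicCompletion ℚ)) δ • m) i =
        resGalOfEmb (closureEmb (K := ℚ) (v.adicCompletion ℚ)) δ • Θ m i)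
    {H : Subgroup (absoluteGaloisGroup ℚ)} [H.Normal] {B : AddSubgroup (localPoints W (v.adicCompletion ℚ))}
    (δ : absoluteGaloisGroup (v.adicCompletion ℚ)) (hB : ∀ a ∈ B, δ • a ∈ B)
    {y : subgroupH1 H (Cofree ρ ↥(padicCoeffField S))} (hy : ThetaKummerAt S ρ W Θ v H B y) :
    ThetaKummerAt S ρ W Θ v H B
      (Literature.NumberTheory.EllipticCurves.conjH1 H (Cofree ρ ↥(padicCoeffField S))
        (resGalOfEmb (closureEmb (K := ℚ) (v.adicCompletion ℚ)) δ) y) := by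
  set ι := closureEmb (K := ℚ) (v.adicCompletion ℚ) with hι
  obtain ⟨φ, Q, k, rfl, hQ, hτ⟩ := hy
  refine ⟨conjCocycle H (resGalOfEmb ι δ) φ, fun i ↦ δ • Q i, k, (conjH1_oneCocycleClass H (resGalOfEmb ι δ) φ).symm,
    fun i ↦ by rw [smul_comm]; exact hB _ (hQ i), fun τ i ↦ ?_⟩
  have hτ' : δ⁻¹ * (τ : absoluteGaloisGroup (v.adicCompletion ℚ)) * δ ∈ localSubgroupOfEmb H ι := by
    rw [mem_localSubgroupOfEmb_iff, map_mul, map_mul, map_inv]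
    exact ‹H.Normal›.conj_mem' _ ((mem_localSubgroupOfEmb_iff H ι _).1 τ.2) _
  have hconj : subgroupConj H (resGalOfEmb ι δ) (resGalSubgroupOfEmb H ι τ) = resGalSubgroupOfEmb H ι ⟨_, hτ'⟩ := by
    apply Subtype.ext
    rw [subgroupConj_apply_coe, resGalSubgroupOfEmb_apply_coe, resGalSubgroupOfEmb_apply_coe, map_mul, map_mul, map_inv]
  rw [conjCocycle_apply, hconj, hΘ, primaryComponent.coe_smul, pointsMapOfEmb_smul, hτ ⟨_, hτ'⟩ i, smul_sub, smul_smul, smul_smul]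
  congr 1
  rw [show δ * (δ⁻¹ * (τ : absoluteGaloisGroup (v.adicCompletion ℚ)) * δ) = (τ : absoluteGaloisGroup (v.adicCompletion ℚ)) * δ by group,
    mul_smul]

/-- **One orbit at `v ∣ p` for the cyclotomic tower, at `Γ_∞`: `Γ_ℚ = θ(Γ_v)·Γ_∞`** (`κ ∘ θ` is onto `ℤ_p`: `p` is totally ramified in `ℚ_∞`).
The `Γ_n`-version is TP2's `SignedKatoOffTwo.LayerPairing.forall_exists_inv_mul_mem_layerSubgroup`. [cite: Washington1997, §13.1] -/
theorem exists_inv_mul_mem_kerSubgroup (hκ : κ.IsCyclotomic) (hv : (p : 𝓞 ℚ) ∈ v.asIdeal) (g : absoluteGaloisGroup ℚ) :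
    ∃ δ : absoluteGaloisGroup (v.adicCompletion ℚ), (resGalOfEmb (closureEmb (K := ℚ) (v.adicCompletion ℚ)) δ)⁻¹ * g ∈ κ.kerSubgroup := by
  obtain ⟨δ, hδ⟩ := hκ.exists_apply_resGalOfEmb_adicCompletion_eq v hv (κ g)
  exact ⟨δ, by rw [mem_kerSubgroup, map_mul, map_inv, hδ, inv_mul_cancel]⟩

/-- **At `v ∣ p` the Θ-Kummer condition at `Γ_∞` w.r.t. a `Γ_v`-stable `B` is stable under EVERY `conj_σ`, `σ ∈ Γ_ℚ`** — so the `∀ σ`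
of RSL_g's clause (3) (all places of `ℚ_∞` above `v`: there is one) reduces to `σ = 1`. (`σ = θ(δ)·u`, `u ∈ Γ_∞` acts trivially —
`conjH1_of_mem_holds` —, then `conjH1_resGalOfEmb`.) [cite: SerreLocalFields1979, VII §5 Prop. 3] [cite: Washington1997, §13.1]
[cite: Kobayashi2003, §2 (p. 4)] -/
theorem conjH1 (hΘ : ∀ (δ : absoluteGaloisGroup (v.adicCompletion ℚ)) (m : Cofree ρ ↥(padicCoeffField S)) (i : Fin r),
      Θ (resGalOfEmb (closureEmb (K := ℚ) (v.adicCompletion ℚ)) δ • m) i =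
        resGalOfEmb (closureEmb (K := ℚ) (v.adicCompletion ℚ)) δ • Θ m i)
    (hκ : κ.IsCyclotomic) (hv : (p : 𝓞 ℚ) ∈ v.asIdeal) {B : AddSubgroup (localPoints W (v.adicCompletion ℚ))}
    (hB : ∀ (δ : absoluteGaloisGroup (v.adicCompletion ℚ)), ∀ a ∈ B, δ • a ∈ B)
    {y : subgroupH1 κ.kerSubgroup (Cofree ρ ↥(padicCoeffField S))} (hy : ThetaKummerAt S ρ W Θ v κ.kerSubgroup B y)
    (σ : absoluteGaloisGroup ℚ) :
    ThetaKummerAt S ρ W Θ v κ.kerSubgroup B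
      (Literature.NumberTheory.EllipticCurves.conjH1 κ.kerSubgroup (Cofree ρ ↥(padicCoeffField S)) σ y) := by
  obtain ⟨δ, hδ⟩ := exists_inv_mul_mem_kerSubgroup (κ := κ) (v := v) hκ hv σ
  have hσ : σ = resGalOfEmb (closureEmb (K := ℚ) (v.adicCompletion ℚ)) δ *
      ((resGalOfEmb (closureEmb (K := ℚ) (v.adicCompletion ℚ)) δ)⁻¹ * σ) := by rw [mul_inv_cancel_left]
  rw [hσ, conjH1_mul_holds κ.kerSubgroup (Cofree ρ ↥(padicCoeffField S)), AddMonoidHom.comp_apply,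
    conjH1_of_mem_holds κ.kerSubgroup (Cofree ρ ↥(padicCoeffField S)) hδ, AddMonoidHom.id_apply]
  exact conjH1_resGalOfEmb hΘ δ (hB δ) hy

end ThetaKummerAt

/-! ## §2 T3♮ — the level-`n` Θ-Kummer witness of the pushed class (ρ/Θ-twin of TP2's `exists_kummerWitness_push_of_layerLoc_eq_layerKummer`) -/

/-- The inclusion `A_ρ[N] ↪ A_ρ` is `Γ_ℚ`-equivariant (hypothesis shape of `pushH1`). [cite: SerreGaloisCohomology1997, I §2.1] -/
theorem torsionBy_subtype_smul (N : ℤ) (g : absoluteGaloisGroup ℚ) (x : ↥(AddSubgroup.torsionBy (Cofree ρ ↥(padicCoeffField S)) N)) :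
    (AddSubgroup.torsionBy (Cofree ρ ↥(padicCoeffField S)) N).subtype (g • x) =
      g • (AddSubgroup.torsionBy (Cofree ρ ↥(padicCoeffField S)) N).subtype x :=
  rfl

/-- `τ_{n,N} : H¹(Γ_n, A_ρ[N]) → H¹(Γ_∞, A_ρ)` — push along `A_ρ[N] ↪ A_ρ`, restrict to `Γ_∞` (k3-g13's `transferH1`, same term).
[cite: PerrinRiou1994Asterisque229, §1.3] [cite: NeukirchSchmidtWingberg2008, I §5] -/
abbrev transferH1 (N : ℤ) (n : ℕ) :
    subgroupH1 (κ.layerSubgroup n) ↥(AddSubgroup.torsionBy (Cofree ρ ↥(padicCoeffField S)) N) →+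
      subgroupH1 κ.kerSubgroup (Cofree ρ ↥(padicCoeffField S)) :=
  (Literature.NumberTheory.EllipticCurves.resOfLe (Cofree ρ ↥(padicCoeffField S)) (κ.kerSubgroup_le_layerSubgroup n)).comp
    (pushH1 (κ.layerSubgroup n) (AddSubgroup.torsionBy (Cofree ρ ↥(padicCoeffField S)) N).subtype (torsionBy_subtype_smul S ρ N))

/-- Evaluation of continuous cocycles at a group element, as an additive map (to move finite sums of cocycles to values).
[cite: SerreGaloisCohomology1997, I §2.2] -/
def cocycleEval {G : Type} [Group G] [TopologicalSpace G] [IsTopologicalGroup G] (Y : TopRep.{0} ℤ G) (g : G) :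
    contOneCocycles Y →+ Y where
  toFun φ := φ.1 g
  map_zero' := rfl
  map_add' _ _ := rfl

variable [W.IsElliptic]

set_option maxHeartbeats 400000 in
include hΘ in
/-- **T3♮ (level `n`).** If the localisation at `U_n` of `b ∈ H¹(Γ_n, A_ρ[p^k])` is the Θ-Kummer class of `P ∈ E(ℚ_{n,v})^r`
(`layerLocOf b = thetaLayerKummer … n P`), then the pushed class `(A_ρ[p^k] ↪ A_ρ)_* b ∈ H¹(Γ_n, A_ρ)` has a Θ-Kummer witness `(φ, R)`
with `p^k • R_i = P_i` EXACTLY: `ι((Θ φ(res τ))_i) = τR_i − R_i` on `U_n`. Proof: cocycles `β` of `b` and `Σ_i Θ⁻¹(κ_{U_n}(P_i)·δ_i)` have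
the same class on `U_n`, so differ by `τt − t`, `t ∈ A_ρ[p^k]`; read through `Θ` (additive, `hΘ`-equivariant) and `ι`, coordinate `i` gives
`(τP'_i − P'_i) + (τT_i − T_i)` with `p^k P'_i = P_i`, `T_i = ι((Θt)_i)` of order `p^k`; `R_i := P'_i + T_i`.
[cite: Kobayashi2003, (8.23) (p. 18)] [cite: SilvermanAEC2009, VIII §2] [cite: Greenberg1989, §1 p. 98] -/
theorem exists_thetaKummerWitness_pushH1 (n k : ℕ)
    (b : subgroupH1 (κ.layerSubgroup n) ↥(AddSubgroup.torsionBy (Cofree ρ ↥(padicCoeffField S)) ((p ^ k : ℕ) : ℤ)))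
    (P : Fin r → ↥(localLayerPointsOfEmb κ (closureEmb (K := ℚ) (v.adicCompletion ℚ)) W n))
    (hkum : layerLocOf (cofreeTorsionGaloisModule S ρ ((p ^ k : ℕ) : ℤ)) κ v n b = thetaLayerKummer S ρ k W Θ κ v hΘ n P) :
    ∃ (φ : contOneCocycles (discreteTopRep (κ.layerSubgroup n) (Cofree ρ ↥(padicCoeffField S))))
      (R : Fin r → localPoints W (v.adicCompletion ℚ)),
      oneCocycleClass _ φ =
          pushH1 (κ.layerSubgroup n) (AddSubgroup.torsionBy (Cofree ρ ↥(padicCoeffField S)) ((p ^ k : ℕ) : ℤ)).subtype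
            (torsionBy_subtype_smul S ρ _) b ∧
        (∀ i, (p ^ k) • R i = (P i : localPoints W (v.adicCompletion ℚ))) ∧
        ∀ (τ : localSubgroupOfEmb (κ.layerSubgroup n) (closureEmb (K := ℚ) (v.adicCompletion ℚ))) (i : Fin r),
          pointsMapOfEmb W (closureEmb (K := ℚ) (v.adicCompletion ℚ))
              (((Θ (φ.1 (resGalSubgroupOfEmb (κ.layerSubgroup n) (closureEmb (K := ℚ) (v.adicCompletion ℚ)) τ))) i :
                  ↥(W.geomPrimaryTorsion p)) : W.geomPoints) =
            (τ : absoluteGaloisGroup (v.adicCompletion ℚ)) • R i - R i := by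
  have hN : ((p ^ k : ℕ) : ℤ) ≠ 0 := by exact_mod_cast NeZero.ne (p ^ k)
  -- a cocycle `β` of `b`; roots `P' i` of the points `P i` and their Kummer cocycles `c i` on `U_n`
  obtain ⟨β, rfl⟩ := oneCocycleClass_surjective (discreteTopRep (κ.layerSubgroup n) ↥(AddSubgroup.torsionBy (Cofree ρ ↥(padicCoeffField S)) ((p ^ k : ℕ) : ℤ))) b
  obtain ⟨P', hR⟩ : ∃ P' : Fin r → localPoints W (v.adicCompletion ℚ), ∀ i, ((p ^ k : ℕ) : ℤ) • P' i = (P i : localPoints W (v.adicCompletion ℚ)) :=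
    ⟨fun i ↦ W.subgroupZSMulRoot ((p ^ k : ℕ) : ℤ) hN (P i : localPoints W (v.adicCompletion ℚ)), fun i ↦ W.zsmul_subgroupZSMulRoot _ hN _⟩
  have hfix : ∀ i, ((p ^ k : ℕ) : ℤ) • P' i ∈ FixedPoints.addSubgroup (layerGroup κ v n) (localPoints W (v.adicCompletion ℚ)) := fun i ↦ by
    rw [hR i]; exact (P i).2
  obtain ⟨c, hc⟩ : ∃ c : ∀ i : Fin r, contOneCocycles (subgroupRep (torsionLocalRep W (p ^ k) v) (layerGroup κ v n)),
      ∀ i, c i = W.subgroupKummerCocycle ((p ^ k : ℕ) : ℤ) (layerGroup κ v n) hN (P' i) (hfix i) := ⟨_, fun _ ↦ rfl⟩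
  have hK : ∀ i, layerKummer W (p ^ k) κ v n (P i) = oneCocycleClass _ (c i) := fun i ↦ by
    rw [hc i]
    change W.subgroupKummerMap ((p ^ k : ℕ) : ℤ) (layerGroup κ v n) hN (P i) = _
    rw [W.subgroupKummerMap_apply_eq _ _ hN (P i) (P' i) (hfix i) (hR i)]
    rfl
  -- the Θ-Kummer class of `P` is the class of `ψ := Σ_i Θ⁻¹(c_i·δ_i)`
  obtain ⟨ψ, hψ⟩ : ∃ ψ : contOneCocycles (subgroupRep (cofreeTorsionLocalRep S ρ ((p ^ k : ℕ) : ℤ) v) (layerGroup κ v n)),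
      ψ = ∑ i : Fin r, contOneCocycles.pushAddHom (thetaSingle ρ p k W Θ i) continuous_of_discreteTopology
        (thetaSingle_subgroupRep S ρ k W Θ κ v hΘ i n) (c i) := ⟨_, rfl⟩
  have hT : thetaLayerKummer S ρ k W Θ κ v hΘ n P =
      oneCocycleClass (subgroupRep (cofreeTorsionLocalRep S ρ ((p ^ k : ℕ) : ℤ) v) (layerGroup κ v n)) ψ := by
    have hi : ∀ i : Fin r, thetaSingleH1 S ρ k W Θ κ v hΘ i n (layerKummer W (p ^ k) κ v n (P i)) =
        oneCocycleClassₗ _ (contOneCocycles.pushAddHom (thetaSingle ρ p k W Θ i) continuous_of_discreteTopology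
          (thetaSingle_subgroupRep S ρ k W Θ κ v hΘ i n) (c i)) := fun i ↦ by
      rw [hK i, thetaSingleH1_oneCocycleClass, oneCocycleClassₗ_apply]
    rw [thetaLayerKummer_apply, hψ, ← oneCocycleClassₗ_apply, map_sum]
    exact Finset.sum_congr rfl fun i _ ↦ hi i
  have hL : layerLocOf (cofreeTorsionGaloisModule S ρ ((p ^ k : ℕ) : ℤ)) κ v n
        (oneCocycleClass (discreteTopRep (κ.layerSubgroup n) ↥(AddSubgroup.torsionBy (Cofree ρ ↥(padicCoeffField S)) ((p ^ k : ℕ) : ℤ))) β) =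
      oneCocycleClass (subgroupRep (cofreeTorsionLocalRep S ρ ((p ^ k : ℕ) : ℤ) v) (layerGroup κ v n))
        (contOneCocycles.pullback (resGalSubgroupOfEmb (κ.layerSubgroup n) (closureEmb (K := ℚ) (v.adicCompletion ℚ)))
          (X := subgroupRep (cofreeTorsionGaloisModule S ρ ((p ^ k : ℕ) : ℤ)).toTopRep (κ.layerSubgroup n))
          (Y := subgroupRep (cofreeTorsionLocalRep S ρ ((p ^ k : ℕ) : ℤ) v) (layerGroup κ v n))
          (TopRep.ofHom ⟨ContinuousLinearMap.id ℤ ↥(AddSubgroup.torsionBy (Cofree ρ ↥(padicCoeffField S)) ((p ^ k : ℕ) : ℤ)), fun _ => rfl⟩) β) :=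
    map_oneCocycleClass _ _ _ β
  rw [hL, hT, ← sub_eq_zero, ← oneCocycleClass_sub, oneCocycleClass_eq_zero_iff] at hkum
  obtain ⟨t, ht⟩ := hkum
  -- the torsion points `T i := ι((Θ t)_i)`; the roots are `R i := P' i + T i`
  obtain ⟨T, hTdef⟩ : ∃ T : Fin r → localPoints W (v.adicCompletion ℚ),
      ∀ i, T i = pointsMapOfEmb W (closureEmb (K := ℚ) (v.adicCompletion ℚ)) (((Θ (t : (Cofree ρ ↥(padicCoeffField S)))) i : ↥(W.geomPrimaryTorsion p)) : W.geomPoints) := ⟨_, fun _ ↦ rfl⟩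
  have hR' : ∀ i, (p ^ k) • P' i = (P i : localPoints W (v.adicCompletion ℚ)) := fun i ↦ by
    rw [← natCast_zsmul]; exact hR i
  have hT0 : ∀ i, (p ^ k) • T i = 0 := fun i ↦ by
    have h := (WeierstrassCurve.mem_geomTorsion_iff W _ _).1 (coe_theta_apply_mem_geomTorsion ρ p k W Θ t i)
    rw [natCast_zsmul] at h
    rw [hTdef i, ← map_nsmul, h, map_zero]
  -- values of `ψ` read through `Θ`: coordinate `i` is the Kummer cocycle `c i`
  have hψval : ∀ (τ : layerGroup κ v n) (i : Fin r),
      Θ ((ψ.1 τ : ↥(AddSubgroup.torsionBy (Cofree ρ ↥(padicCoeffField S)) ((p ^ k : ℕ) : ℤ))) : (Cofree ρ ↥(padicCoeffField S))) i =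
        AddSubgroup.inclusion (geomTorsion_natCast_pow_le_geomPrimaryTorsion p k W) ((c i).1 τ) := by
    intro τ i
    have e1 : ψ.1 τ = ∑ j : Fin r, thetaSingle ρ p k W Θ j ((c j).1 τ) := by
      change cocycleEval _ τ ψ = _
      rw [hψ, map_sum]
      rfl
    rw [e1, AddSubmonoidClass.coe_finsetSum, sum_thetaSingle, AddEquiv.apply_symm_apply]
  -- the Kummer cocycle `c i` read on `E(ℚ̄_v)`
  have hkum' : ∀ (τ : layerGroup κ v n) (i : Fin r),
      pointsMapOfEmb W (closureEmb (K := ℚ) (v.adicCompletion ℚ)) ((AddSubgroup.inclusion (geomTorsion_natCast_pow_le_geomPrimaryTorsion p k W) ((c i).1 τ) :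
        ↥(W.geomPrimaryTorsion p)) : W.geomPoints) = (τ : absoluteGaloisGroup (v.adicCompletion ℚ)) • P' i - P' i := fun τ i ↦ by
    rw [hc i]
    exact W.pointsMap_subgroupKummerCocycle_apply _ _ hN (P' i) (hfix i) τ
  -- the coboundary identity at `τ`, read on `E(ℚ̄_v)` in coordinate `i`
  have hval : ∀ (τ : layerGroup κ v n) (i : Fin r),
      pointsMapOfEmb W (closureEmb (K := ℚ) (v.adicCompletion ℚ)) (((Θ ((β.1 (resGalSubgroupOfEmb (κ.layerSubgroup n) (closureEmb (K := ℚ) (v.adicCompletion ℚ)) τ) :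
          ↥(AddSubgroup.torsionBy (Cofree ρ ↥(padicCoeffField S)) ((p ^ k : ℕ) : ℤ))) : (Cofree ρ ↥(padicCoeffField S)))) i : ↥(W.geomPrimaryTorsion p)) : W.geomPoints) =
        (τ : absoluteGaloisGroup (v.adicCompletion ℚ)) • (P' i + T i) - (P' i + T i) := by
    intro τ i
    have h := ht τ
    change β.1 (resGalSubgroupOfEmb (κ.layerSubgroup n) (closureEmb (K := ℚ) (v.adicCompletion ℚ)) τ) - ψ.1 τ = _ at h
    rw [sub_eq_iff_eq_add] at h
    -- `β(res τ) = (τ•t − t) + ψ τ` in `A_ρ[p^k]`; coerce to `A_ρ`, apply `Θ`, take coordinate `i`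
    have h2 : ((β.1 (resGalSubgroupOfEmb (κ.layerSubgroup n) (closureEmb (K := ℚ) (v.adicCompletion ℚ)) τ) : ↥(AddSubgroup.torsionBy (Cofree ρ ↥(padicCoeffField S)) ((p ^ k : ℕ) : ℤ))) : (Cofree ρ ↥(padicCoeffField S))) =
        (resGalOfEmb (closureEmb (K := ℚ) (v.adicCompletion ℚ)) (τ : absoluteGaloisGroup (v.adicCompletion ℚ)) • (t : (Cofree ρ ↥(padicCoeffField S))) - (t : (Cofree ρ ↥(padicCoeffField S)))) +
          ((ψ.1 τ : ↥(AddSubgroup.torsionBy (Cofree ρ ↥(padicCoeffField S)) ((p ^ k : ℕ) : ℤ))) : (Cofree ρ ↥(padicCoeffField S))) := by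
      rw [h]; rfl
    have h3 : (Θ ((β.1 (resGalSubgroupOfEmb (κ.layerSubgroup n) (closureEmb (K := ℚ) (v.adicCompletion ℚ)) τ) : ↥(AddSubgroup.torsionBy (Cofree ρ ↥(padicCoeffField S)) ((p ^ k : ℕ) : ℤ))) : (Cofree ρ ↥(padicCoeffField S)))) i =
        (resGalOfEmb (closureEmb (K := ℚ) (v.adicCompletion ℚ)) (τ : absoluteGaloisGroup (v.adicCompletion ℚ)) • Θ (t : (Cofree ρ ↥(padicCoeffField S))) i - Θ (t : (Cofree ρ ↥(padicCoeffField S))) i) +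
          AddSubgroup.inclusion (geomTorsion_natCast_pow_le_geomPrimaryTorsion p k W) ((c i).1 τ) := by
      rw [h2, map_add, map_sub, Pi.add_apply, Pi.sub_apply, hψval τ i, hΘ]
    rw [h3, AddMemClass.coe_add, map_add, hkum' τ i, AddSubgroupClass.coe_sub, map_sub, primaryComponent.coe_smul,
      pointsMapOfEmb_smul, ← hTdef i, smul_add]
    abel
  refine ⟨contOneCocycles.pullback (ContinuousMonoidHom.id (κ.layerSubgroup n))
      (resHomOfEquivariant (ContinuousMonoidHom.id (κ.layerSubgroup n)) (AddSubgroup.torsionBy (Cofree ρ ↥(padicCoeffField S)) ((p ^ k : ℕ) : ℤ)).subtype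
        fun g x ↦ torsionBy_subtype_smul S ρ ((p ^ k : ℕ) : ℤ) g x) β,
    fun i ↦ P' i + T i, ?_, fun i ↦ ?_, fun τ i ↦ ?_⟩
  · exact (resH1Hom_oneCocycleClass _ _ _ β).symm
  · rw [smul_add, hR' i, hT0 i, add_zero]
  · rw [pullback_resHomOfEquivariant_apply]
    exact hval τ i

/-! ## §3 GLUE — T3♮ + ORB: the transferred class and all its conjugates satisfy the Θ-Kummer clause over `ℚ_∞` for every `Γ_v`-stable `B ∋ P_i` -/

include hΘ in
/-- **(T3♭ discharged, abstract `B`).** At `v ∣ p`, cyclotomic `κ`: if `layerLocOf b = thetaLayerKummer … n P` and `B` is a `Γ_v`-stable group of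
points containing the `P_i`, then for every `σ ∈ Γ_ℚ` the class `conj_σ (τ_{n,p^k} b) ∈ H¹(Γ_∞, A_ρ)` satisfies the Θ-Kummer condition
w.r.t. `B`. (`exists_thetaKummerWitness_pushH1` at `Γ_n`, `ThetaKummerAt.resOfLe` to `Γ_∞`, `ThetaKummerAt.conjH1` for the orbit.)
[cite: Kobayashi2003, (8.23) (p. 18)] [cite: PerrinRiou1994Asterisque229, §1.3] [cite: Washington1997, §13.1] -/
theorem thetaKummerAt_conjH1_transferH1 (hκ : κ.IsCyclotomic) (hv : (p : 𝓞 ℚ) ∈ v.asIdeal) (n k : ℕ)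
    (b : subgroupH1 (κ.layerSubgroup n) ↥(AddSubgroup.torsionBy (Cofree ρ ↥(padicCoeffField S)) ((p ^ k : ℕ) : ℤ)))
    (P : Fin r → ↥(localLayerPointsOfEmb κ (closureEmb (K := ℚ) (v.adicCompletion ℚ)) W n))
    (hkum : layerLocOf (cofreeTorsionGaloisModule S ρ ((p ^ k : ℕ) : ℤ)) κ v n b = thetaLayerKummer S ρ k W Θ κ v hΘ n P)
    (B : AddSubgroup (localPoints W (v.adicCompletion ℚ)))
    (hB : ∀ (δ : absoluteGaloisGroup (v.adicCompletion ℚ)), ∀ a ∈ B, δ • a ∈ B)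
    (hPB : ∀ i, (P i : localPoints W (v.adicCompletion ℚ)) ∈ B) (σ : absoluteGaloisGroup ℚ) :
    ThetaKummerAt S ρ W Θ v κ.kerSubgroup B
      (Literature.NumberTheory.EllipticCurves.conjH1 κ.kerSubgroup (Cofree ρ ↥(padicCoeffField S)) σ
        (transferH1 S ρ κ ((p ^ k : ℕ) : ℤ) n b)) := by
  refine ThetaKummerAt.conjH1 hΘ hκ hv hB (ThetaKummerAt.resOfLe (κ.kerSubgroup_le_layerSubgroup n) ?_) σ
  obtain ⟨φ, R, hφ, hR, hτ⟩ := exists_thetaKummerWitness_pushH1 S ρ W Θ κ v hΘ n k b P hkum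
  exact ⟨φ, R, k, hφ, fun i ↦ by rw [hR i]; exact hPB i, hτ⟩

include hΘ in
/-- **The same with the hypothesis in RANGE form** — exactly what item 6's levelwise call delivers at `v ∣ p` for a class of the DUAL
structure (self-dual local condition `L_n = thetaLayerKummer(E(ℚ_{n,v})^r)`, B7 «points^⊥ = points»): `loc_n b ∈ L_n`.
[cite: Kobayashi2003, (8.23) (p. 18)] [cite: GreenbergLNM1716, §2] -/
theorem thetaKummerAt_conjH1_transferH1_of_mem_range (hκ : κ.IsCyclotomic) (hv : (p : 𝓞 ℚ) ∈ v.asIdeal) (n k : ℕ)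
    (b : subgroupH1 (κ.layerSubgroup n) ↥(AddSubgroup.torsionBy (Cofree ρ ↥(padicCoeffField S)) ((p ^ k : ℕ) : ℤ)))
    (hL : layerLocOf (cofreeTorsionGaloisModule S ρ ((p ^ k : ℕ) : ℤ)) κ v n b ∈ (thetaLayerKummer S ρ k W Θ κ v hΘ n).range)
    (B : AddSubgroup (localPoints W (v.adicCompletion ℚ)))
    (hB : ∀ (δ : absoluteGaloisGroup (v.adicCompletion ℚ)), ∀ a ∈ B, δ • a ∈ B)
    (hnB : localLayerPointsOfEmb κ (closureEmb (K := ℚ) (v.adicCompletion ℚ)) W n ≤ B) (σ : absoluteGaloisGroup ℚ) :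
    ThetaKummerAt S ρ W Θ v κ.kerSubgroup B
      (Literature.NumberTheory.EllipticCurves.conjH1 κ.kerSubgroup (Cofree ρ ↥(padicCoeffField S)) σ
        (transferH1 S ρ κ ((p ^ k : ℕ) : ℤ) n b)) := by
  obtain ⟨P, hP⟩ := hL
  exact thetaKummerAt_conjH1_transferH1 S ρ W Θ κ v hΘ hκ hv n k b P hP.symm B hB (fun i ↦ hnB (P i).2) σ

/-! ## §4 The three target groups `B`: all tower points (C4's relaxed clause (3♭)), `⨆_m E(ℚ_{m,v})`, and `⨆_m E^ε(ℚ_{m,v})` (RSL_g's clause (3)) -/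

omit [Fact p.Prime] [W.IsElliptic] in
/-- `Γ_v`-stability passes to `⨆_m L_m`. [cite: Kobayashi2003, Def. 1.1] -/
theorem smul_mem_iSup_of_forall {L : ℕ → AddSubgroup (localPoints W (v.adicCompletion ℚ))} (δ : absoluteGaloisGroup (v.adicCompletion ℚ))
    (hL : ∀ m, ∀ a ∈ L m, δ • a ∈ L m) {a : localPoints W (v.adicCompletion ℚ)} (ha : a ∈ ⨆ m, L m) : δ • a ∈ ⨆ m, L m := by
  refine AddSubgroup.iSup_induction (C := fun a ↦ δ • a ∈ ⨆ m, L m) L ha (fun m a ha ↦ ?_) (by rw [smul_zero]; exact zero_mem _)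
    fun a b ha hb ↦ by rw [smul_add]; exact add_mem ha hb
  exact (le_iSup L m) (hL m a ha)

omit [W.IsElliptic] in
/-- **All tower points `E(ℚ_∞·ℚ_v)` are `Γ_v`-stable** (`Gal(ℚ̄_v/ℚ_∞·ℚ_v)` is normal in `Γ_v`). [cite: Sprung2012, §1 p. 1486] -/
theorem smul_mem_localTowerPointsOfEmb (δ : absoluteGaloisGroup (v.adicCompletion ℚ)) {a : localPoints W (v.adicCompletion ℚ)}
    (ha : a ∈ localTowerPointsOfEmb κ (closureEmb (K := ℚ) (v.adicCompletion ℚ)) W) :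
    δ • a ∈ localTowerPointsOfEmb κ (closureEmb (K := ℚ) (v.adicCompletion ℚ)) W := by
  haveI : (localSubgroupOfEmb κ.kerSubgroup (closureEmb (K := ℚ) (v.adicCompletion ℚ))).Normal := Subgroup.Normal.comap inferInstance _
  exact W.smul_mem_fixedPoints_addSubgroup_of_normal _ δ ha

include hΘ in
/-- **Clause (3♭) of the v2 cut's relaxed set (all tower points), UNFOLDED, for every conjugate of the transferred class** — item 6's
T3♭ with NO Coates–Greenberg input: the hypothesis is Kummer-ness AT LEVEL `n` (`loc_n b ∈ L_n`), which the dual structure supplies.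
[cite: Kobayashi2003, (8.23) (p. 18)] [cite: Sprung2012, §1 p. 1486] [cite: Washington1997, §13.1] -/
theorem conjH1_transferH1_kummer_towerPoints (hκ : κ.IsCyclotomic) (hv : (p : 𝓞 ℚ) ∈ v.asIdeal) (n k : ℕ)
    (b : subgroupH1 (κ.layerSubgroup n) ↥(AddSubgroup.torsionBy (Cofree ρ ↥(padicCoeffField S)) ((p ^ k : ℕ) : ℤ)))
    (hL : layerLocOf (cofreeTorsionGaloisModule S ρ ((p ^ k : ℕ) : ℤ)) κ v n b ∈ (thetaLayerKummer S ρ k W Θ κ v hΘ n).range)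
    (σ : absoluteGaloisGroup ℚ) :
    ∃ (φ : contOneCocycles (discreteTopRep κ.kerSubgroup (Cofree ρ ↥(padicCoeffField S))))
      (Q : Fin r → localPoints W (v.adicCompletion ℚ)) (k' : ℕ),
      oneCocycleClass _ φ =
          Literature.NumberTheory.EllipticCurves.conjH1 κ.kerSubgroup (Cofree ρ ↥(padicCoeffField S)) σ
            (transferH1 S ρ κ ((p ^ k : ℕ) : ℤ) n b) ∧
        (∀ i, (p ^ k') • Q i ∈ localTowerPointsOfEmb κ (closureEmb (K := ℚ) (v.adicCompletion ℚ)) W) ∧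
        ∀ (τ : localSubgroupOfEmb κ.kerSubgroup (closureEmb (K := ℚ) (v.adicCompletion ℚ))) (i : Fin r),
          pointsMapOfEmb W (closureEmb (K := ℚ) (v.adicCompletion ℚ))
              (((Θ (φ.1 (resGalSubgroupOfEmb κ.kerSubgroup (closureEmb (K := ℚ) (v.adicCompletion ℚ)) τ))) i :
                  ↥(W.geomPrimaryTorsion p)) : W.geomPoints) =
            (τ : absoluteGaloisGroup (v.adicCompletion ℚ)) • Q i - Q i :=
  thetaKummerAt_conjH1_transferH1_of_mem_range S ρ W Θ κ v hΘ hκ hv n k b hL _ (smul_mem_localTowerPointsOfEmb W κ v)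
    (localLayerPointsOfEmb_le_localTowerPointsOfEmb κ _ W n) σ

include hΘ in
/-- **The `⨆_m E(ℚ_{m,v})` form of clause (3♭)** (if the lead's `SelRel` spells «all tower points» as the union of the layers).
[cite: Kobayashi2003, Def. 1.1, (8.23) (p. 18)] -/
theorem conjH1_transferH1_kummer_iSup_layerPoints (hκ : κ.IsCyclotomic) (hv : (p : 𝓞 ℚ) ∈ v.asIdeal) (n k : ℕ)
    (b : subgroupH1 (κ.layerSubgroup n) ↥(AddSubgroup.torsionBy (Cofree ρ ↥(padicCoeffField S)) ((p ^ k : ℕ) : ℤ)))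
    (hL : layerLocOf (cofreeTorsionGaloisModule S ρ ((p ^ k : ℕ) : ℤ)) κ v n b ∈ (thetaLayerKummer S ρ k W Θ κ v hΘ n).range)
    (σ : absoluteGaloisGroup ℚ) :
    ThetaKummerAt S ρ W Θ v κ.kerSubgroup (⨆ m, localLayerPointsOfEmb κ (closureEmb (K := ℚ) (v.adicCompletion ℚ)) W m)
      (Literature.NumberTheory.EllipticCurves.conjH1 κ.kerSubgroup (Cofree ρ ↥(padicCoeffField S)) σ
        (transferH1 S ρ κ ((p ^ k : ℕ) : ℤ) n b)) :=
  thetaKummerAt_conjH1_transferH1_of_mem_range S ρ W Θ κ v hΘ hκ hv n k b hL _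
    (fun δ _ ha ↦ smul_mem_iSup_of_forall W v δ (fun m _ hx ↦ smul_mem_localLayerPointsOfEmb κ _ W m δ hx) ha)
    (le_iSup (localLayerPointsOfEmb κ (closureEmb (K := ℚ) (v.adicCompletion ℚ)) W) n) σ

include hΘ in
/-- **RSL_g's SIGNED clause (3) VERBATIM (`B = ⨆_m E^ε(ℚ_{m,v})`) when the level points are ε-signed**: `P_i ∈ E^ε(ℚ_{n,v})` ⟹ every
`conj_σ (τ b)` has a Θ-Kummer witness with `p^k Q_i ∈ ⨆_m E^ε(ℚ_{m,v})` (`E^ε(ℚ_{m,v})` is `Γ_v`-stable: TP2's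
`smul_mem_signedLocalPointsOfEmb`). For `p = 2`, `ε = 1` this is the third clause of the set counted in `ResidualSignedLambdaLowerCMAtTwo`.
[cite: Kobayashi2003, Def. 1.1, (8.23) (p. 18)] [cite: Washington1997, §13.1] -/
theorem conjH1_transferH1_kummer_signed (hκ : κ.IsCyclotomic) (hv : (p : 𝓞 ℚ) ∈ v.asIdeal) (ε : ℤˣ) (n k : ℕ)
    (b : subgroupH1 (κ.layerSubgroup n) ↥(AddSubgroup.torsionBy (Cofree ρ ↥(padicCoeffField S)) ((p ^ k : ℕ) : ℤ)))
    (P : Fin r → ↥(localLayerPointsOfEmb κ (closureEmb (K := ℚ) (v.adicCompletion ℚ)) W n))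
    (hPε : ∀ i, (P i : localPoints W (v.adicCompletion ℚ)) ∈ signedLocalPoints κ (v.adicCompletion ℚ) W ε n)
    (hkum : layerLocOf (cofreeTorsionGaloisModule S ρ ((p ^ k : ℕ) : ℤ)) κ v n b = thetaLayerKummer S ρ k W Θ κ v hΘ n P)
    (σ : absoluteGaloisGroup ℚ) :
    ∃ (φ : contOneCocycles (discreteTopRep κ.kerSubgroup (Cofree ρ ↥(padicCoeffField S))))
      (Q : Fin r → localPoints W (v.adicCompletion ℚ)) (k' : ℕ),
      oneCocycleClass _ φ =
          Literature.NumberTheory.EllipticCurves.conjH1 κ.kerSubgroup (Cofree ρ ↥(padicCoeffField S)) σ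
            (transferH1 S ρ κ ((p ^ k : ℕ) : ℤ) n b) ∧
        (∀ i, (p ^ k') • Q i ∈ ⨆ m : ℕ, signedLocalPoints κ (v.adicCompletion ℚ) W ε m) ∧
        ∀ (τ : localSubgroupOfEmb κ.kerSubgroup (closureEmb (K := ℚ) (v.adicCompletion ℚ))) (i : Fin r),
          pointsMapOfEmb W (closureEmb (K := ℚ) (v.adicCompletion ℚ))
              (((Θ (φ.1 (resGalSubgroupOfEmb κ.kerSubgroup (closureEmb (K := ℚ) (v.adicCompletion ℚ)) τ))) i :
                  ↥(W.geomPrimaryTorsion p)) : W.geomPoints) =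
            (τ : absoluteGaloisGroup (v.adicCompletion ℚ)) • Q i - Q i :=
  thetaKummerAt_conjH1_transferH1 S ρ W Θ κ v hΘ hκ hv n k b P hkum _
    (fun δ _ ha ↦ smul_mem_iSup_of_forall W v δ
      (fun m _ hx ↦ SignedLowerOffTwo.PTDeep.smul_mem_signedLocalPointsOfEmb κ _ W ε m δ hx) ha)
    (fun i ↦ (le_iSup (fun m ↦ signedLocalPoints κ (v.adicCompletion ℚ) W ε m) n) (hPε i)) σ

/-- **`N`-torsion bookkeeping**: the transferred classes are `N`-torsion once `N • b = 0` (which holds for every class of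
`H¹(Γ_n, A_ρ[N])` — cocycles valued in `A_ρ[N]`; k3-g13's T-file records the same; consumers typed on `Sel[ϖ^k]`).
[cite: SerreGaloisCohomology1997, I §2.2] -/
theorem zsmul_transferH1_eq_zero (N : ℤ) (n : ℕ)
    (b : subgroupH1 (κ.layerSubgroup n) ↥(AddSubgroup.torsionBy (Cofree ρ ↥(padicCoeffField S)) N)) (hb : N • b = 0) :
    N • transferH1 S ρ κ N n b = 0 := by
  rw [← map_zsmul, hb, map_zero]

end Summit.BirchSwinnertonDyer.BirchSwinnertonDyer.Cruxes.ResidualThetaCountLowerPureAtTwo.StubIdeasK3G14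

/-! ## §5 `p = 2`, in the BINDER SHAPE of RSL_g: `Θ`, `hΘ` as families over `v ∣ 2`, clause (3) with `signedLocalPoints … 1 m` (PLUS) -/

namespace Summit.BirchSwinnertonDyer.BirchSwinnertonDyer.Cruxes.ResidualThetaCountLowerPureAtTwo.StubIdeasK3G14

open Field IsDedekindDomain NumberField
  Literature.NumberTheory.EllipticCurves Literature.NumberTheory.GaloisRepresentations
  Literature.NumberTheory.EllipticCurves.GreenbergSelmer Literature.NumberTheory.EllipticCurves.GreenbergVatsal2000
  Literature.NumberTheory.EllipticCurves.Kobayashi2003 Literature.NumberTheory.EllipticCurves.Sprung2012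
  Literature.NumberTheory.EllipticCurves.CyclotomicLayer ZpExtension
  Summit.BirchSwinnertonDyer.BirchSwinnertonDyer.Theorems

set_option maxHeartbeats 400000 in
/-- **Item 6's [kum] ⟹ clause (3) of RSL_g's counted set, at `p = 2`, for every conjugate of a transferred level class** — the
binders `Θ`, `hΘ` in the shape of `ResidualSignedLambdaLowerCMAtTwo` (families over `v ∋ 2`), the conclusion its third clause
VERBATIM with `y := transferH1 … b` (`(2 ^ k') • Q i ∈ ⨆ m, signedLocalPoints κ ℚ_v W 1 m` = Kobayashi PLUS). Hypothesis [kum]: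
at each `v ∋ 2` the level-`n₀` localisation of `b` is the Θ-Kummer class of PLUS points `P ∈ (E⁺(ℚ_{n₀,v}))ʳ` — what S4₂'s
strict levelwise structure (B7 «points^⊥ = points», plus side) supplies. No Coates–Greenberg (T47), no pins, any `S`, `d`, `r`.
[cite: Kobayashi2003, Def. 1.1, (8.23) (p. 18)] [cite: Washington1997, §13.1] [cite: Greenberg1989, §1 p. 98] -/
theorem clauseThree_conjH1_transferH1_atTwo (S₂ : Set (PadicAlgCl 2)) {d₂ : ℕ} (ρ₂ : FramedGaloisRep ℚ ↥(padicCoeffIntegers S₂) d₂)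
    (E : WeierstrassCurve ℚ) [E.IsElliptic] {n : ℕ}
    (Θf : ∀ v : HeightOneSpectrum (𝓞 ℚ), ((2 : ℕ) : 𝓞 ℚ) ∈ v.asIdeal →
      (Cofree ρ₂ ↥(padicCoeffField S₂) ≃+ (Fin n → ↥(E.geomPrimaryTorsion 2))))
    (hΘf : ∀ v hv (δ : absoluteGaloisGroup (v.adicCompletion ℚ)) m i,
      Θf v hv (resGalOfEmb (closureEmb (K := ℚ) (v.adicCompletion ℚ)) δ • m) i =
        resGalOfEmb (closureEmb (K := ℚ) (v.adicCompletion ℚ)) δ • Θf v hv m i)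
    (κ₂ : ZpExtension ℚ 2) (hκ₂ : κ₂.IsCyclotomic) (n₀ k : ℕ)
    (b : subgroupH1 (κ₂.layerSubgroup n₀) ↥(AddSubgroup.torsionBy (Cofree ρ₂ ↥(padicCoeffField S₂)) ((2 ^ k : ℕ) : ℤ)))
    (hkum : ∀ v (hv : ((2 : ℕ) : 𝓞 ℚ) ∈ v.asIdeal),
      ∃ P : Fin n → ↥(localLayerPointsOfEmb κ₂ (closureEmb (K := ℚ) (v.adicCompletion ℚ)) E n₀),
        (∀ i, (P i : localPoints E (v.adicCompletion ℚ)) ∈ signedLocalPoints κ₂ (v.adicCompletion ℚ) E 1 n₀) ∧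
        layerLocOf (cofreeTorsionGaloisModule S₂ ρ₂ ((2 ^ k : ℕ) : ℤ)) κ₂ v n₀ b =
          thetaLayerKummer S₂ ρ₂ k E (Θf v hv) κ₂ v (hΘf v hv) n₀ P) :
    ∀ v (hv : ((2 : ℕ) : 𝓞 ℚ) ∈ v.asIdeal) (σ : absoluteGaloisGroup ℚ),
      ∃ (φ : _) (Q : Fin n → localPoints E (v.adicCompletion ℚ)) (k' : ℕ),
        oneCocycleClass (discreteTopRep ↥κ₂.kerSubgroup (Cofree ρ₂ ↥(padicCoeffField S₂))) φ =
            Literature.NumberTheory.EllipticCurves.conjH1 κ₂.kerSubgroup (Cofree ρ₂ ↥(padicCoeffField S₂)) σ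
              (transferH1 S₂ ρ₂ κ₂ ((2 ^ k : ℕ) : ℤ) n₀ b) ∧
          (∀ i, (2 ^ k') • Q i ∈ ⨆ m : ℕ, signedLocalPoints κ₂ (v.adicCompletion ℚ) E 1 m) ∧
          ∀ τ i, pointsMapOfEmb E (closureEmb (K := ℚ) (v.adicCompletion ℚ))
              (((Θf v hv (φ.1 (resGalSubgroupOfEmb κ₂.kerSubgroup (closureEmb (K := ℚ) (v.adicCompletion ℚ)) τ))) i :
                  ↥(E.geomPrimaryTorsion 2)) : E.geomPoints) =
            (τ : absoluteGaloisGroup (v.adicCompletion ℚ)) • Q i - Q i := by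
  intro v hv σ
  obtain ⟨P, hPε, hP⟩ := hkum v hv
  exact conjH1_transferH1_kummer_signed S₂ ρ₂ E (Θf v hv) κ₂ v (hΘf v hv) hκ₂ hv 1 n₀ k b P hPε hP σ

end Summit.BirchSwinnertonDyer.BirchSwinnertonDyer.Cruxes.ResidualThetaCountLowerPureAtTwo.StubIdeasK3G14

end
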